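import Summits.BirchSwinnertonDyer.BirchSwinnertonDyer.Theorems.CyclotomicUntwistIrrNotSurjThreeCubeClass
import Summits.BirchSwinnertonDyer.Rank1Residual.WAll.Target
import HarnessLib

/-!
# LAW L-irr3 on the W-ALL corner X10b («`3` good ordinary, `E[3]` irreducible, `ρ̄₃` NOT onto»):
# every curve of the corner has `Δ_min ≡ ±1 (mod 9)` and `E[3]|G_{ℚ₃}` without a unique stable line

Cell `pub/bsd-wall` (D-0145 line `route-BirchSwinnertonDyer-CyclotomicUntwist`), seat `bsd-line-cycu-p4`
(width seat 4, gen 6). THEOREMS ONLY (no definition, no named fact, no `sorry`); route-free; BSD is not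
proved by this file and the corner is NOT closed by it — it is CONFINED. Helper `--supports` K1
(stmt-BirchSwinnertonDyer-21580; the law is the same as on K1's rows: `Irr ⇒ Surj` at `3` off the
`3`-adic cube class, `…IrrNotSurjThreeCubeClass.cubeClass_of_irr_of_not_surj`).

The W-ALL corner `WAllCornerX10b` (`WAll/Target.lean`, row 10: non-CM, `ClassX10 W p` — `p = 3`, good
ordinary at `3`, `E[3]` irreducible, `(r = 0 ∧ ¬ram) ∨ (r = 1 ∧ ¬sst)` — and `¬ Surj W p`, `r ≤ 1` ⇒
`BSD(E,p)`) quantifies over curves whose mod-`3` image is irreducible but not onto. By LAW L-irr3 such a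
curve has `Δ_min ∈ (ℚ₃ˣ)³`; at a prime of good reduction `v₃(Δ_min) = 0`, so the condition is
**`Δ_min ≡ ±1 (mod 9)`** (`minimalDiscriminantInt_emod_nine_of_classX10_of_not_surj`), and `E[3]|G_{ℚ₃}`
is IRR or SPLIT, never one stable line (`numStableLinesAtThree_ne_one_of_classX10_of_not_surj`). Hence
**`wAllCornerX10b_iff_emod_nine`**: the corner is equivalent to its restriction to `Δ_min ≡ ±1 (mod 9)`
— the complementary congruence classes `Δ_min ≡ ±2, ±4 (mod 9)` carry NO corner-X10b curve.

References: J.-P. Serre, Invent. Math. 15 (1972) §2.4 Prop. 15, §5.3 [Serre1972]; cell files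
`WAll/Target.lean` (row 10), `Rank1Residual/Predicates.lean` (`ClassX10`).
-/

-- single-conjunct summit: `Summit.BirchSwinnertonDyer.BirchSwinnertonDyer.…` repeats the name by design
set_option linter.dupNamespace false
set_option autoImplicit false

noncomputable section

open scoped Classical

namespace Summit.BirchSwinnertonDyer.BirchSwinnertonDyer.Theorems.PSIrrSurjThree

open WeierstrassCurve Literature.NumberTheory.EllipticCurves Literature.NumberTheory.EllipticCurves.Rank1Residual
  Summit.BirchSwinnertonDyer.Rank1Residual Summit.BirchSwinnertonDyer.Rank1Residual.O5

variable (W : WeierstrassCurve ℚ) [W.IsElliptic] [W.IsGloballyMinimal]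

omit [W.IsElliptic] in
/-- At a prime of good reduction the minimal discriminant is a unit: `v₃(Δ_min) = 0` for `GoodOrd W 3`.
[cite: SilvermanAEC2009, VII.5.1] -/
theorem padicValInt_minimalDiscriminantInt_eq_zero_of_goodOrd (h : GoodOrd W 3) :
    padicValInt 3 W.minimalDiscriminantInt = 0 :=
  haveI : Fact (Nat.Prime 3) := ⟨Nat.prime_three⟩
  padicValInt.eq_zero_of_not_dvd (W.not_dvd_minimalDiscriminantInt_of_hasGoodReductionAtPrime' 3 h.1)

/-- **Corner X10b curves have `Δ_min ≡ ±1 (mod 9)`**: `ClassX10 W p` (good ordinary at `3`, `E[3]`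
irreducible) and `ρ̄_{E,p}` not onto force `Δ_min % 9 ∈ {1, 8}` (`cubeClass_of_irr_of_not_surj` with
`v₃(Δ_min) = 0`). [cite: Serre1972, §2.4 Prop. 15 and §5.3] -/
theorem minimalDiscriminantInt_emod_nine_of_classX10_of_not_surj {p : ℕ} [Fact p.Prime]
    (hX : ClassX10 W p) (hns : ¬ Surj W p) :
    W.minimalDiscriminantInt % 9 = 1 ∨ W.minimalDiscriminantInt % 9 = 8 := by
  obtain ⟨rfl, hgo, hirr, -⟩ := hX
  have h := (cubeClass_of_irr_of_not_surj W hirr hns).2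
  rwa [padicValInt_minimalDiscriminantInt_eq_zero_of_goodOrd W hgo, pow_zero, Int.ediv_one] at h

/-- **Corner X10b curves have no unique stable line at `3`** (`E[3]|G_{ℚ₃}` is IRR or SPLIT).
[cite: Serre1972, §2.4 Prop. 15] -/
theorem numStableLinesAtThree_ne_one_of_classX10_of_not_surj {p : ℕ} [Fact p.Prime]
    (hX : ClassX10 W p) (hns : ¬ Surj W p) : numStableLinesAtThree W ≠ 1 := by
  obtain ⟨rfl, -, hirr, -⟩ := hX
  exact numStableLinesAtThree_ne_one_of_irr_of_not_surj W hirr hns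

omit [W.IsElliptic] [W.IsGloballyMinimal] W in
/-- **The W-ALL corner X10b is confined to `Δ_min ≡ ±1 (mod 9)`**: `WAllCornerX10b` is equivalent to its
restriction to the curves with `Δ_min % 9 ∈ {1, 8}`; on `Δ_min ≡ ±2, ±4 (mod 9)` an irreducible `E[3]`
at a good ordinary `3` has onto `ρ̄₃`, so the corner is empty there. [cite: Serre1972, §2.4 Prop. 15 and §5.3] -/
theorem wAllCornerX10b_iff_emod_nine :
    WAllCornerX10b ↔
      ∀ (W : WeierstrassCurve ℚ) [W.IsElliptic] [W.IsGloballyMinimal] (p : ℕ) [Fact p.Prime],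
        ¬ W.HasCM → ClassX10 W p → ¬ Surj W p →
        (W.minimalDiscriminantInt % 9 = 1 ∨ W.minimalDiscriminantInt % 9 = 8) →
        W.analyticRank ≤ 1 → BSDp W p :=
  ⟨fun h W _ _ p _ hCM hX hns _ hr ↦ h W p hCM hX hns hr,
    fun h W _ _ p _ hCM hX hns hr ↦
      h W p hCM hX hns (minimalDiscriminantInt_emod_nine_of_classX10_of_not_surj W hX hns) hr⟩

end Summit.BirchSwinnertonDyer.BirchSwinnertonDyer.Theorems.PSIrrSurjThree

end
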